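import Summits.ResolutionOfSingularities.ResolutionOfSingularities.Theorems.PurelyInseparableDim4SpineGame
import Summits.ResolutionOfSingularities.ResolutionOfSingularities.Theorems.PurelyInseparableDim4GameDeterminacy
import HarnessLib
import HarnessLib.Audit.Tags

/-!
# Purely inseparable fourfolds — the SPINE GAME is positionally determined
# [OURS · counted 0 · a statement about OUR frame (`PurelyInseparableDim4SpineGame`), not about resolution]

Census cell «res-dim4-pi» (D-0157 DOOR 2), width seat `res-dim4-p-14`, brick PR-12c: the link
«positional extraction» of the desk's PR-9c chain (WORD #25 (e)):
Spivakovsky 1983 (`∀` positions, A can force a win) → **positional** winning strategy → TY-9's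
`PurePositionalWin4 q` → PR-9a → PR-9b → F4-S.

TY-9 (`PurelyInseparableDim4SpineGame`) types Hironaka's original polyhedra game on supports
(`SpinePos = Finset (Fin 4 →₀ ℕ)`, permissible `J`, pure move / spine move, `SpineWon`) and asks for a
POSITIONAL winning strategy (`PurePositionalWin4`, `PositionalWin4`).  `PurelyInseparableDim4GameDeterminacy`
proves, for an abstract reachability game, that a positional strategy winning from every position
exists iff every position lies in player A's attractor `Game.Wins` (the history-free meaning of «A has
a winning strategy from here»), iff there is no nonempty trap.  This DEF-FREE file instantiates:

* `isPurePositionalWin_iff` / `isSpinePositionalWin_iff` — TY-9's positional wins ARE the abstract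
  ones for `legal A J := ¬ SpineWon q A ∧ SpinePermissible q J A`, `succ A J A' := ∃ j ∈ J, A' = move`
  (the only non-definitional point: at a position not yet won the whole set `univ` is permissible,
  `spinePermissible_univ_of_not_spineWon`);
* **`purePositionalWin4_iff_forall_wins`**, **`purePositionalWin4_of_forall_wins`** (and the
  `PositionalWin4` twins): ANY proof that A wins the pure game from every position — e.g. Spivakovsky's
  history-free «there exists a winning strategy», read as membership in the attractor — yields
  `PurePositionalWin4 q`; «positional» costs nothing (W3-7 (i) / WORD #22 (c)(i) answered in the
  kernel);
* **`not_purePositionalWin4_iff_exists_pureTrap`** (and the spine twin): the EXACT kill shape for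
  TY-9's hypotheses — a nonempty set of not-yet-won positions in which every permissible `J` has a
  chart `j ∈ J` whose move stays in the set.  A literal cycle under ONE strategy kills that strategy
  only; a pure trap would contradict Spivakovsky's theorem (so the census expects none: a K-sanity
  target for MODE S / the spine shards).

Nothing here asserts that any position is won or lost; nothing here proves resolution of
singularities in dimension ≥ 4 / characteristic `p`; counted 0; AI work, weaker than expert review.
bears_on: LADDER-RESOLUTION:D157-DOOR2 (res-dim4-pi · PR-12c). Supports stmt-ResolutionOfSingularities-16155
(helper).
-/

set_option linter.dupNamespace false

namespace Summit.ResolutionOfSingularities.ResolutionOfSingularities.Theorems.PIDim4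

namespace SpinePositional

open Literature.AlgebraicGeometry.Resolution

variable (q : ℕ)

/-! ## 1. Legality on the spine: «not yet won» = «some permissible `J`» -/

/-- At a position A has not yet won, the whole set of variables is permissible (`|a| ≥ q` for every
point). [cite: Spivakovsky1983, §1 (the initial assumption Σ xᵢ ≥ 1)] [folklore] -/
theorem spinePermissible_univ_of_not_spineWon {A : SpinePos} (h : ¬ SpineWon q A) :
    SpinePermissible q Finset.univ A := by
  refine ⟨Finset.univ_nonempty, fun a ha => ?_⟩
  rw [CentreBlowup.degIn_univ]
  by_contra hlt
  exact h (Or.inr ⟨a, ha, not_le.mp hlt⟩)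

/-- A has a legal move iff A has not yet won. [folklore] -/
theorem exists_legal_iff_not_spineWon (A : SpinePos) :
    (∃ J : Finset (Fin 4), ¬ SpineWon q A ∧ SpinePermissible q J A) ↔ ¬ SpineWon q A :=
  ⟨fun ⟨_, h, _⟩ => h, fun h => ⟨_, h, spinePermissible_univ_of_not_spineWon q h⟩⟩

/-! ## 2. TY-9's positional wins are the abstract positional wins -/

/-- **Pure game**: `IsPurePositionalWin q σ` is `Game.IsWinningPositional` for the pure move.
[folklore] -/
theorem isPurePositionalWin_iff (σ : SpineStrategy) :
    IsPurePositionalWin q σ ↔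
      Game.IsWinningPositional
        (fun (A : SpinePos) (J : Finset (Fin 4)) => ¬ SpineWon q A ∧ SpinePermissible q J A)
        (fun A J A' => ∃ j ∈ J, A' = pureMove q J j A) σ := by
  unfold IsPurePositionalWin Game.IsWinningPositional IsPurePlay
  constructor
  · rintro ⟨h1, h2⟩
    refine ⟨fun A hA => ?_, ?_⟩
    · obtain ⟨-, hW, -⟩ := hA
      exact ⟨hW, h1 A hW⟩
    · rintro ⟨c, hc⟩
      exact h2 ⟨c, fun k => ⟨(hc k).1.1, (hc k).2⟩⟩
  · rintro ⟨h1, h2⟩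
    refine ⟨fun A hA => (h1 A ⟨Finset.univ, hA, spinePermissible_univ_of_not_spineWon q hA⟩).2, ?_⟩
    rintro ⟨c, hc⟩
    exact h2 ⟨c, fun k =>
      ⟨h1 (c k) ⟨Finset.univ, (hc k).1, spinePermissible_univ_of_not_spineWon q (hc k).1⟩, (hc k).2⟩⟩

/-- **Spine game (with deletions)**: `IsSpinePositionalWin q σ` is `Game.IsWinningPositional` for the
spine move. [folklore] -/
theorem isSpinePositionalWin_iff (σ : SpineStrategy) :
    IsSpinePositionalWin q σ ↔
      Game.IsWinningPositional
        (fun (A : SpinePos) (J : Finset (Fin 4)) => ¬ SpineWon q A ∧ SpinePermissible q J A)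
        (fun A J A' => ∃ j ∈ J, A' = spineMove q J j A) σ := by
  unfold IsSpinePositionalWin Game.IsWinningPositional IsSpinePlay
  constructor
  · rintro ⟨h1, h2⟩
    refine ⟨fun A hA => ?_, ?_⟩
    · obtain ⟨-, hW, -⟩ := hA
      exact ⟨hW, h1 A hW⟩
    · rintro ⟨c, hc⟩
      exact h2 ⟨c, fun k => ⟨(hc k).1.1, (hc k).2⟩⟩
  · rintro ⟨h1, h2⟩
    refine ⟨fun A hA => (h1 A ⟨Finset.univ, hA, spinePermissible_univ_of_not_spineWon q hA⟩).2, ?_⟩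
    rintro ⟨c, hc⟩
    exact h2 ⟨c, fun k =>
      ⟨h1 (c k) ⟨Finset.univ, (hc k).1, spinePermissible_univ_of_not_spineWon q (hc k).1⟩, (hc k).2⟩⟩

/-! ## 3. Positional determinacy of the spine game -/

/-- **`PurePositionalWin4 q` ⟺ every position lies in A's attractor of the pure game.** [folklore] -/
theorem purePositionalWin4_iff_forall_wins :
    PurePositionalWin4 q ↔
      ∀ A : SpinePos, Game.Wins
        (fun (A : SpinePos) (J : Finset (Fin 4)) => ¬ SpineWon q A ∧ SpinePermissible q J A)
        (fun A J A' => ∃ j ∈ J, A' = pureMove q J j A) A := by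
  unfold PurePositionalWin4
  simp only [isPurePositionalWin_iff]
  exact (Game.forall_wins_iff_exists_isWinningPositional _ _).symm

/-- **The consortium interface (WORD #25 (e))**: ANY proof that player A wins Hironaka's pure game
from every position of `SpinePos` — membership in the attractor, no strategy bookkeeping, no
positionality — discharges TY-9's hypothesis `PurePositionalWin4 q`.
[cite: Spivakovsky1983, Theorem and Remark 1 (the strategy depends only on the current Δ)] [folklore] -/
theorem purePositionalWin4_of_forall_wins
    (h : ∀ A : SpinePos, Game.Wins
      (fun (A : SpinePos) (J : Finset (Fin 4)) => ¬ SpineWon q A ∧ SpinePermissible q J A)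
      (fun A J A' => ∃ j ∈ J, A' = pureMove q J j A) A) :
    PurePositionalWin4 q :=
  (purePositionalWin4_iff_forall_wins q).mpr h

/-- Conversely a positional win puts every position in the attractor. [folklore] -/
theorem wins_of_purePositionalWin4 (h : PurePositionalWin4 q) (A : SpinePos) :
    Game.Wins
      (fun (A : SpinePos) (J : Finset (Fin 4)) => ¬ SpineWon q A ∧ SpinePermissible q J A)
      (fun A J A' => ∃ j ∈ J, A' = pureMove q J j A) A :=
  (purePositionalWin4_iff_forall_wins q).mp h A

/-- **`PositionalWin4 q` ⟺ every position lies in A's attractor of the spine game (with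
deletions).** [folklore] -/
theorem positionalWin4_iff_forall_wins :
    PositionalWin4 q ↔
      ∀ A : SpinePos, Game.Wins
        (fun (A : SpinePos) (J : Finset (Fin 4)) => ¬ SpineWon q A ∧ SpinePermissible q J A)
        (fun A J A' => ∃ j ∈ J, A' = spineMove q J j A) A := by
  unfold PositionalWin4
  simp only [isSpinePositionalWin_iff]
  exact (Game.forall_wins_iff_exists_isWinningPositional _ _).symm

/-- Interface for the spine game: attractor everywhere ⇒ `PositionalWin4 q`. [folklore] -/
theorem positionalWin4_of_forall_wins
    (h : ∀ A : SpinePos, Game.Wins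
      (fun (A : SpinePos) (J : Finset (Fin 4)) => ¬ SpineWon q A ∧ SpinePermissible q J A)
      (fun A J A' => ∃ j ∈ J, A' = spineMove q J j A) A) :
    PositionalWin4 q :=
  (positionalWin4_iff_forall_wins q).mpr h

/-! ## 4. The kill shapes: pure traps and spine traps -/

/-- **`PurePositionalWin4 q` fails iff a nonempty PURE TRAP exists**: a set of not-yet-won positions
in which every permissible `J` has a chart `j ∈ J` whose pure move stays in the set. [folklore] -/
theorem not_purePositionalWin4_iff_exists_pureTrap :
    ¬ PurePositionalWin4 q ↔ ∃ T : Set SpinePos, T.Nonempty ∧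
      ∀ A ∈ T, ¬ SpineWon q A ∧ ∀ J, SpinePermissible q J A → ∃ j ∈ J, pureMove q J j A ∈ T := by
  rw [purePositionalWin4_iff_forall_wins, Game.forall_wins_iff_not_exists_trap, not_not]
  refine exists_congr fun T => and_congr Iff.rfl ?_
  unfold Game.IsTrapSet
  refine forall₂_congr fun A _ => ?_
  rw [exists_legal_iff_not_spineWon]
  refine ⟨fun ⟨hW, h⟩ => ⟨hW, fun J hJ => ?_⟩, fun ⟨hW, h⟩ => ⟨hW, fun J hJ => ?_⟩⟩
  · obtain ⟨_, hmem, j, hj, rfl⟩ := h J ⟨hW, hJ⟩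
    exact ⟨j, hj, hmem⟩
  · obtain ⟨j, hj, hmem⟩ := h J hJ.2
    exact ⟨_, hmem, j, hj, rfl⟩

/-- **`PositionalWin4 q` fails iff a nonempty SPINE TRAP exists** (same shape with the spine move).
[folklore] -/
theorem not_positionalWin4_iff_exists_spineTrap :
    ¬ PositionalWin4 q ↔ ∃ T : Set SpinePos, T.Nonempty ∧
      ∀ A ∈ T, ¬ SpineWon q A ∧ ∀ J, SpinePermissible q J A → ∃ j ∈ J, spineMove q J j A ∈ T := by
  rw [positionalWin4_iff_forall_wins, Game.forall_wins_iff_not_exists_trap, not_not]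
  refine exists_congr fun T => and_congr Iff.rfl ?_
  unfold Game.IsTrapSet
  refine forall₂_congr fun A _ => ?_
  rw [exists_legal_iff_not_spineWon]
  refine ⟨fun ⟨hW, h⟩ => ⟨hW, fun J hJ => ?_⟩, fun ⟨hW, h⟩ => ⟨hW, fun J hJ => ?_⟩⟩
  · obtain ⟨_, hmem, j, hj, rfl⟩ := h J ⟨hW, hJ⟩
    exact ⟨j, hj, hmem⟩
  · obtain ⟨j, hj, hmem⟩ := h J hJ.2
    exact ⟨_, hmem, j, hj, rfl⟩

/-- A position inside a pure trap is not in the attractor (no strategy wins from it). [folklore] -/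
theorem not_wins_of_mem_pureTrap {T : Set SpinePos}
    (hT : ∀ A ∈ T, ¬ SpineWon q A ∧ ∀ J, SpinePermissible q J A → ∃ j ∈ J, pureMove q J j A ∈ T)
    {A : SpinePos} (hA : A ∈ T) :
    ¬ Game.Wins
      (fun (A : SpinePos) (J : Finset (Fin 4)) => ¬ SpineWon q A ∧ SpinePermissible q J A)
      (fun A J A' => ∃ j ∈ J, A' = pureMove q J j A) A := by
  intro hW
  refine hW.not_mem_of_isTrapSet _ _ (T := T) (fun B hB => ?_) hA
  obtain ⟨hBW, h⟩ := hT B hB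
  refine ⟨⟨Finset.univ, hBW, spinePermissible_univ_of_not_spineWon q hBW⟩, fun J hJ => ?_⟩
  obtain ⟨j, hj, hmem⟩ := h J hJ.2
  exact ⟨_, hmem, j, hj, rfl⟩

end SpinePositional

end Summit.ResolutionOfSingularities.ResolutionOfSingularities.Theorems.PIDim4
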